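import Summits.BirchSwinnertonDyer.Rank1Residual.Additive.CyclotomicTowerSignedSelmerEtaSummand
import Summits.BirchSwinnertonDyer.Rank1Residual.Additive.BaseChangeSubgroupH1
import Summits.BirchSwinnertonDyer.Rank1Residual.Additive.QuadraticTowerRestrict
import Literature.NumberTheory.EllipticCurves.KitajimaOtsuki2018.PlusSelmerNoFiniteSubmodule
import HarnessLib

/-!
# From the `Γ_{K₀}`-internal signed Selmer group of the Literature (`Kobayashi2003.signedSelmerInfty
# (V⁄K₀) κ|_{Γ_{K₀}} ε`, base `K₀`) to cc-typer-6's `Γ_ℚ`-internal tower object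
# (`towerSignedSelmerInfty V κ K₀ ℚ_[p] ε`, base `ℚ`): the transport map on `H¹`, the induced
# transport of Pontryagin-dual data, and Kitajima–Otsuki's Main Thm. 1.3 (the NAMED Literature fact,
# sign `+`) delivered to the tower dual MODULO ONE displayed identification of Selmer conditions
# (cell `bsd-potss`, seat `bsd-potss-k8q-c5` g0; K8 crux (R2±), items 19117 / 19222; the interface
# brick shared with crux 19115's piece (i): ctrl's (i-c4)/(i-f))

HONEST FRAMING (cell `bsd-potss`, run/shared/lean/pub/bsd-potss/; FULL-BSD rank ≤ 1 programme,
tranche 1b): INFRASTRUCTURE + ONE CONDITIONAL DELIVERY — two transparent definitions (the transport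
`towerTransport = subgroupH1Iso ∘ res`, ctrl's bricks (i-b) `restrictGal` and (i-c3) `subgroupH1Iso`
composed; the transported datum `TowerSignedSelmerDualData.toKobayashi`, SAME module) and THEOREMS;
no named Literature fact minted, no `Prop` definition, no `sorry`, axioms standard. The ONE displayed
hypothesis `hSel` is the IDENTIFICATION OF SELMER CONDITIONS under the transport —
`towerTransport (Sel^ε(V_{K₀}/K₀·K_∞^{κ'})) = Sel^ε(V/K₀ℚ_∞)` as subgroups of `H¹(Gal(ℚ̄/K₀ℚ_∞), V[p^∞])`
(classical conditions at every place, Kobayashi's signed condition above `p` at the two models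
`v.adicCompletion K₀` / `ℚ_[p]`) — which is EXACTLY the unbuilt bricks (i-c4) "Selmer CONDITIONS under
`subgroupH1Iso`" + (i-f) "adicCompletion ↔ ℚ_[p] model transfer" of ctrl's piece (i) (HANDOFF g2/g3),
here for `K₀ = ℚ(μ_p)` instead of `F = ℚ(√p*)`: a statement about the TREE'S OWN objects (no
literature content), true for `ε = 1` on paper (same group `Sel⁺(E/ℚ(μ_{p^∞}))` seen from `K₀` or
from `ℚ`; Kobayashi Def. 2.1 / Kitajima–Otsuki Def. 2.1 — ONE prime above `p`), NOT expected for
`ε = −1` (the Literature minus object lacks the printed `m = −1` clause). NOTHING about Kitajima–Otsuki's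
theorem is asserted: `TowerSignedSelmerDualData.forall_finite_eq_bot_of_mainThm13` CONSUMES the named
fact `KitajimaOtsuki2018.mainThm13_plusSelmerDual_noFiniteSubmodule` as a hypothesis. Nothing is
booked; no label / mark / count moves.

## What (`K₀/ℚ` a number field with `κ(Gal(ℚ̄/K₀)) = ℤ_p` — automatic for `K₀ = ℚ(μ_p)`,
## `kappa_surjOn_galRange_cyclotomic`; `κ' = κ|_{Γ_{K₀}} = BaseChange.restrictGal K₀ κ hκ₀`)

* §1 `towerTransport K₀ V κ hκ₀ : H¹(ker κ', V_{K₀}[p^∞]) → H¹(U_∞, V[p^∞])` (`U_∞ = ker κ ⊓ Gal(ℚ̄/K₀)`,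
  `ker κ' = res⁻¹ U_∞` by `kerSubgroup_restrictGal`): restriction along the subgroup equality then
  ctrl's `subgroupH1Iso`; injective; `towerTransport ∘ conj_{g'} = conj_{g'|_{ℚ̄}} ∘ towerTransport`.
* §2 `TowerSignedSelmerDualData.toKobayashi`: GIVEN the identification `hSel`, a full tower datum `D`
  at `γ = γ'|_{ℚ̄}` IS a `Kobayashi2003.SignedSelmerDualData (V⁄K₀) κ' γ' ε` with the SAME module
  `D.X` (`toDual` precomposed with the transport, a bijection `Sel^ε(V_{K₀}/…) ≃ Sel^ε(V/K₀ℚ_∞)`;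
  `T ↔ conj_{γ'} − 1` matches `conj_γ − 1` by §1).
* §3 **`TowerSignedSelmerDualData.forall_finite_eq_bot_of_mainThm13`**: for `K₀ = ℚ(μ_p)`, `V/ℚ` good
  at the odd `p` with `a_p = 0`, `κ` cyclotomic, `γ ∈ Gal(ℚ̄/K₀)` a topological generator, GIVEN `hSel`
  at `ε = 1`: the named fact ⟹ every full tower datum `D` (finitely generated, `Λ`-torsion — the
  fact's displayed (vi)) has no non-zero finite `Λ`-submodule. With FILE 2's descent
  (`EtaSignedSelmerDualData.forall_finite_eq_bot_of_tower`) this is the `η`-frame `hKO` of ctrl's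
  (R2⁺) discharge, hence the K8 item `NoFiniteSubmodulePlus`, modulo: the named fact, Kobayashi
  Thm. 2.2 for `X⁺(E/K_∞)`, and `hSel` (Theorems-side file).

References: [KitajimaOtsuki2018] Main Thm. 1.3, Def. 2.1, §4 (arXiv:1607.03612 pp. 3, 6, 18);
[Kobayashi2003] Def. 2.1 (p. 5), §3 p. 5; [SerreGaloisCohomology1997] I.§2.4–2.5, II.§1.1 (restriction,
conjugation, change of base field); [Washington1997] §13.1 (the cyclotomic `ℤ_p`-extension of `K₀`).
-/

noncomputable section

open scoped Classical

namespace Summit.BirchSwinnertonDyer.Rank1Residual.Additive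

open Literature.NumberTheory.EllipticCurves Literature.NumberTheory.GaloisRepresentations
  Literature.NumberTheory.EllipticCurves.IwasawaAlgebra Literature.NumberTheory.EllipticCurves.IwasawaDual
  Literature.NumberTheory.EllipticCurves.Kobayashi2003 ZpExtension
  Summit.BirchSwinnertonDyer.Rank1Residual.Additive.BaseChange

/-! ## §1 The transport `H¹(ker κ', V_{K₀}[p^∞]) → H¹(U_∞, V[p^∞])` -/

section Transport

variable (K₀ : Type) [Field K₀] [NumberField K₀] {p : ℕ} [Fact p.Prime] (V : WeierstrassCurve ℚ)
  (κ : ZpExtension ℚ p) (hκ₀ : ∀ x : Multiplicative ℤ_[p], ∃ g ∈ galRange (K := ℚ) K₀, κ g = x)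

/-- `U_∞ = ker κ ⊓ Gal(ℚ̄/K₀) ≤ Gal(ℚ̄/K₀)`. [cite: Kobayashi2003, §2 p. 4] -/
theorem towerTopSubgroup_le_galRange : towerTopSubgroup κ K₀ ≤ galRange (K := ℚ) K₀ :=
  inf_le_right

/-- `res⁻¹ U_∞ ≤ ker κ'` (the two subgroups of `Γ_{K₀}` coincide, `kerSubgroup_restrictGal`).
[cite: Kobayashi2003, §2 p. 4 (K_∞ = K₀ℚ_∞)] -/
theorem comapResGal_towerTop_le_kerSubgroup :
    comapResGal K₀ (towerTopSubgroup κ K₀) ≤ (restrictGal K₀ κ hκ₀).kerSubgroup :=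
  (kerSubgroup_restrictGal K₀ κ hκ₀).symm.le

/-- `ker κ' ≤ res⁻¹ U_∞`. [cite: Kobayashi2003, §2 p. 4] -/
theorem kerSubgroup_le_comapResGal_towerTop :
    (restrictGal K₀ κ hκ₀).kerSubgroup ≤ comapResGal K₀ (towerTopSubgroup κ K₀) :=
  (kerSubgroup_restrictGal K₀ κ hκ₀).le

/-- **The transport `H¹(Gal(K̄₀/K₀·K_∞^{κ'}), V_{K₀}[p^∞]) → H¹(Gal(ℚ̄/K₀·ℚ_∞^κ), V[p^∞])`**:
restriction along `res⁻¹ U_∞ = ker κ'` followed by ctrl's `subgroupH1Iso` (brick (i-c3)); both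
steps are isomorphisms. [cite: SerreGaloisCohomology1997, I.§2.4 and II.§1.1] -/
def towerTransport :
    (V.baseChange K₀).subgroupH1 p (restrictGal K₀ κ hκ₀).kerSubgroup →+
      V.subgroupH1 p (towerTopSubgroup κ K₀) :=
  (subgroupH1Iso K₀ V p (towerTopSubgroup_le_galRange K₀ κ)).toAddMonoidHom.comp
    ((V.baseChange K₀).resOfLe p (comapResGal_towerTop_le_kerSubgroup K₀ κ hκ₀))

/-- Unfolding `towerTransport` (definitional). [cite: SerreGaloisCohomology1997, I.§2.4] -/
theorem towerTransport_apply (x : (V.baseChange K₀).subgroupH1 p (restrictGal K₀ κ hκ₀).kerSubgroup) :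
    towerTransport K₀ V κ hκ₀ x = subgroupH1Iso K₀ V p (towerTopSubgroup_le_galRange K₀ κ)
      ((V.baseChange K₀).resOfLe p (comapResGal_towerTop_le_kerSubgroup K₀ κ hκ₀) x) :=
  rfl

/-- `towerTransport` is injective (restriction along equal subgroups is injective,
`resOfLe_injective_of_ge`; `subgroupH1Iso` is an isomorphism). [cite: SerreGaloisCohomology1997, I.§2.4] -/
theorem towerTransport_injective : Function.Injective (towerTransport K₀ V κ hκ₀) :=
  (subgroupH1Iso K₀ V p (towerTopSubgroup_le_galRange K₀ κ)).injective.comp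
    (resOfLe_injective_of_ge ((V.baseChange K₀).geomPrimaryTorsion p)
      (comapResGal_towerTop_le_kerSubgroup K₀ κ hκ₀) (kerSubgroup_le_comapResGal_towerTop K₀ κ hκ₀))

/-- **`towerTransport` intertwines conjugation**: `T (conj_{g'} x) = conj_{g'|_{ℚ̄}} (T x)` for
`g' ∈ Γ_{K₀}` (`resOfLe_comp_conjH1`, `subgroupH1Iso_conjH1`). [cite: SerreGaloisCohomology1997, I.§2.5] -/
theorem towerTransport_conjH1 [(galRange (K := ℚ) K₀).Normal] (g' : Field.absoluteGaloisGroup K₀)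
    (x : (V.baseChange K₀).subgroupH1 p (restrictGal K₀ κ hκ₀).kerSubgroup) :
    towerTransport K₀ V κ hκ₀ ((V.baseChange K₀).conjH1 p (restrictGal K₀ κ hκ₀).kerSubgroup g' x) =
      V.conjH1 p (towerTopSubgroup κ K₀) (resGal (K := ℚ) K₀ g') (towerTransport K₀ V κ hκ₀ x) := by
  have hle := comapResGal_towerTop_le_kerSubgroup K₀ κ hκ₀
  rw [towerTransport_apply, towerTransport_apply, ← AddMonoidHom.comp_apply,
    show ((V.baseChange K₀).resOfLe p hle).comp
        ((V.baseChange K₀).conjH1 p (restrictGal K₀ κ hκ₀).kerSubgroup g') =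
      ((V.baseChange K₀).conjH1 p (comapResGal K₀ (towerTopSubgroup κ K₀)) g').comp
        ((V.baseChange K₀).resOfLe p hle) from
      resOfLe_comp_conjH1_holds (M := (V.baseChange K₀).geomPrimaryTorsion p) hle g',
    AddMonoidHom.comp_apply, subgroupH1Iso_conjH1]

end Transport

/-! ## §2 Transport of dual data: a tower datum IS a Literature signed datum over `K₀`, given the
identification of Selmer conditions -/

section DualTransport

variable {K₀ : Type} [Field K₀] [NumberField K₀] {p : ℕ} [Fact p.Prime] {V : WeierstrassCurve ℚ}
  {κ : ZpExtension ℚ p} {hκ₀ : ∀ x : Multiplicative ℤ_[p], ∃ g ∈ galRange (K := ℚ) K₀, κ g = x}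
  [(galRange (K := ℚ) K₀).Normal] {γ : Field.absoluteGaloisGroup ℚ} {ε : ℤˣ}

/-- The transport restricted to the Selmer groups, GIVEN the identification `hSel`: an additive map
`Sel^ε(V_{K₀}/K₀·K_∞^{κ'}) → Sel^ε(V/K₀ℚ_∞)`. [cite: Kobayashi2003, Def. 2.1 (p. 5)] -/
def selmerTransport
    (hSel : (signedSelmerInfty (V.baseChange K₀) (restrictGal K₀ κ hκ₀) ε).map
      (towerTransport K₀ V κ hκ₀) = towerSignedSelmerInfty V κ K₀ ℚ_[p] ε) :
    signedSelmerInfty (V.baseChange K₀) (restrictGal K₀ κ hκ₀) ε →+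
      towerSignedSelmerInfty V κ K₀ ℚ_[p] ε :=
  ((towerTransport K₀ V κ hκ₀).restrict
      (signedSelmerInfty (V.baseChange K₀) (restrictGal K₀ κ hκ₀) ε)).codRestrict
    (towerSignedSelmerInfty V κ K₀ ℚ_[p] ε)
    fun s ↦ by rw [← hSel]; exact AddSubgroup.mem_map_of_mem _ s.2

/-- Unfolding `selmerTransport` (definitional). [cite: Kobayashi2003, Def. 2.1 (p. 5)] -/
@[simp]
theorem coe_selmerTransport_apply
    (hSel : (signedSelmerInfty (V.baseChange K₀) (restrictGal K₀ κ hκ₀) ε).map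
      (towerTransport K₀ V κ hκ₀) = towerSignedSelmerInfty V κ K₀ ℚ_[p] ε)
    (s : signedSelmerInfty (V.baseChange K₀) (restrictGal K₀ κ hκ₀) ε) :
    ((selmerTransport hSel s : towerSignedSelmerInfty V κ K₀ ℚ_[p] ε) :
        V.subgroupH1 p (towerTopSubgroup κ K₀)) = towerTransport K₀ V κ hκ₀ s :=
  rfl

/-- `selmerTransport` is a bijection `Sel^ε(V_{K₀}/K₀·K_∞^{κ'}) ≃ Sel^ε(V/K₀ℚ_∞)` (injective by
`towerTransport_injective`, onto by the identification). [cite: Kobayashi2003, Def. 2.1 (p. 5)] -/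
theorem selmerTransport_bijective
    (hSel : (signedSelmerInfty (V.baseChange K₀) (restrictGal K₀ κ hκ₀) ε).map
      (towerTransport K₀ V κ hκ₀) = towerSignedSelmerInfty V κ K₀ ℚ_[p] ε) :
    Function.Bijective (selmerTransport hSel) := by
  refine ⟨fun s t hst ↦ Subtype.ext (towerTransport_injective K₀ V κ hκ₀
    (congrArg (fun u : towerSignedSelmerInfty V κ K₀ ℚ_[p] ε ↦
      (u : V.subgroupH1 p (towerTopSubgroup κ K₀))) hst)), fun t ↦ ?_⟩
  have ht : (t : V.subgroupH1 p (towerTopSubgroup κ K₀)) ∈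
      (signedSelmerInfty (V.baseChange K₀) (restrictGal K₀ κ hκ₀) ε).map
        (towerTransport K₀ V κ hκ₀) := by rw [hSel]; exact t.2
  obtain ⟨s, hs, hst⟩ := ht
  exact ⟨⟨s, hs⟩, Subtype.ext hst⟩

/-- **Transport of dual data.** GIVEN the identification `hSel` and `γ'|_{ℚ̄} = γ`, a full tower datum
`D : TowerSignedSelmerDualData V κ K₀ ℚ_[p] γ ε` IS a Literature datum
`Kobayashi2003.SignedSelmerDualData (V⁄K₀) κ' γ' ε` with the SAME module `D.X`: `toDual` precomposed
with the bijection `selmerTransport`; `T ↔ conj_{γ'} − 1` is `conj_γ − 1` under the transport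
(`towerTransport_conjH1`); constants unchanged. [cite: Kobayashi2003, Def. 2.1 and Thm. 2.2 (the object only)]
[cite: GreenbergLNM1716, §1 (p. 60)] -/
def TowerSignedSelmerDualData.toKobayashi (D : TowerSignedSelmerDualData V κ K₀ ℚ_[p] γ ε)
    (γ' : Field.absoluteGaloisGroup K₀) (hγ' : resGal (K := ℚ) K₀ γ' = γ)
    (hSel : (signedSelmerInfty (V.baseChange K₀) (restrictGal K₀ κ hκ₀) ε).map
      (towerTransport K₀ V κ hκ₀) = towerSignedSelmerInfty V κ K₀ ℚ_[p] ε) :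
    SignedSelmerDualData (V.baseChange K₀) (restrictGal K₀ κ hκ₀) γ' ε where
  X := D.X
  conj_mem := fun _ hs ↦ conjH1_mem_signedSelmerInfty _ _ ε γ' hs
  toDual := AddMonoidHom.mk' (fun x ↦ (D.toDual x).comp (selmerTransport hSel))
    fun x y ↦ by rw [map_add, AddMonoidHom.add_comp]
  bijective := by
    let e : signedSelmerInfty (V.baseChange K₀) (restrictGal K₀ κ hκ₀) ε ≃+
        towerSignedSelmerInfty V κ K₀ ℚ_[p] ε :=
      AddEquiv.ofBijective _ (selmerTransport_bijective hSel)
    refine ⟨fun x y hxy ↦ D.bijective.1 (AddMonoidHom.ext fun t ↦ ?_), fun χ ↦ ?_⟩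
    · obtain ⟨s, rfl⟩ := (selmerTransport_bijective hSel).2 t
      exact DFunLike.congr_fun (hxy : (D.toDual x).comp (selmerTransport hSel) =
        (D.toDual y).comp (selmerTransport hSel)) s
    · obtain ⟨x, hx⟩ := D.bijective.2 (χ.comp e.symm.toAddMonoidHom)
      refine ⟨x, AddMonoidHom.ext fun s ↦ ?_⟩
      show D.toDual x (selmerTransport hSel s) = χ s
      rw [hx, AddMonoidHom.comp_apply]
      exact congrArg χ (e.symm_apply_apply s)
  toDual_T_smul := fun x s ↦ by
    have hconj : (⟨V.conjH1 p (towerTopSubgroup κ K₀) γ (selmerTransport hSel s),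
          D.conj_mem _ (selmerTransport hSel s).2⟩ : towerSignedSelmerInfty V κ K₀ ℚ_[p] ε) =
        selmerTransport hSel ⟨(V.baseChange K₀).conjH1 p (restrictGal K₀ κ hκ₀).kerSubgroup γ' s,
          conjH1_mem_signedSelmerInfty _ _ ε γ' s.2⟩ :=
      Subtype.ext (by
        change V.conjH1 p (towerTopSubgroup κ K₀) γ (towerTransport K₀ V κ hκ₀ s) =
          towerTransport K₀ V κ hκ₀
            ((V.baseChange K₀).conjH1 p (restrictGal K₀ κ hκ₀).kerSubgroup γ' s)
        rw [towerTransport_conjH1, hγ'])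
    show D.toDual ((PowerSeries.X : IwasawaAlgebra p) • x) (selmerTransport hSel s) =
      D.toDual x (selmerTransport hSel _) - D.toDual x (selmerTransport hSel s)
    rw [D.toDual_T_smul, hconj]
  toDual_C_smul := fun c x s k hk ↦ by
    show D.toDual (PowerSeries.C c • x) (selmerTransport hSel s) = _
    exact D.toDual_C_smul c x (selmerTransport hSel s) k (by rw [← map_nsmul, hk, map_zero])

/-- The transported datum has the SAME module (definitional). [folklore] -/
theorem TowerSignedSelmerDualData.toKobayashi_X (D : TowerSignedSelmerDualData V κ K₀ ℚ_[p] γ ε)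
    (γ' : Field.absoluteGaloisGroup K₀) (hγ' : resGal (K := ℚ) K₀ γ' = γ)
    (hSel : (signedSelmerInfty (V.baseChange K₀) (restrictGal K₀ κ hκ₀) ε).map
      (towerTransport K₀ V κ hκ₀) = towerSignedSelmerInfty V κ K₀ ℚ_[p] ε) :
    (D.toKobayashi γ' hγ' hSel).X = D.X :=
  rfl

end DualTransport

/-! ## §3 Kitajima–Otsuki's Main Thm. 1.3 (the named Literature fact, sign `+`) delivered to the
`Γ_ℚ`-internal tower dual, modulo the identification of Selmer conditions -/

section Delivery

variable (K₀ : Type) [Field K₀] [NumberField K₀] {p : ℕ} [Fact p.Prime]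
  [IsCyclotomicExtension {p} ℚ K₀] [(galRange (K := ℚ) K₀).Normal]
  (V : WeierstrassCurve ℚ) [V.IsElliptic] [V.IsGloballyMinimal] (κ : ZpExtension ℚ p)

/-- **Kitajima–Otsuki Main Thm. 1.3 (`F = ℚ`, sign `+`) ON THE TOWER DUAL, modulo the Selmer
identification.** For `K₀ = ℚ(μ_p)`, `V/ℚ` globally minimal with good reduction at the odd `p` and
`a_p = 0`, the cyclotomic `κ` and a topological generator `γ ∈ Gal(ℚ̄/K₀)`: IF the named fact
`KitajimaOtsuki2018.mainThm13_plusSelmerDual_noFiniteSubmodule` holds and the transport identifies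
`Sel⁺(V_{K₀}/K₀·K_∞)` (Literature, `Γ_{K₀}`-internal, `κ' = κ|_{Γ_{K₀}}`) with `Sel⁺(V/K₀ℚ_∞)`
(cc-typer-6, `Γ_ℚ`-internal) — hypothesis `hSel`, bricks (i-c4)+(i-f) — THEN every full tower datum
`D` whose module is finitely generated `Λ`-torsion has no non-zero finite `Λ`-submodule. Proof: the
fact applied to `V' = V⁄K₀` (`C = 1`), `κ'` (cyclotomic, `isCyclotomic_restrictGal`), `γ'` the lift
of `γ` (`rangeToResGal`), and the transported datum `D.toKobayashi` (same module). CONDITIONAL on the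
named fact and on `hSel`; nothing asserted.
[cite: KitajimaOtsuki2018, Main Thm. 1.3 (= Thm. 4.8) with Def. 2.1 (arXiv:1607.03612 pp. 3, 6)]
[cite: Kobayashi2003, Def. 2.1 (p. 5), §3 p. 5 (Γ ≅ ℤ_p, γ ∈ Γ)] -/
theorem TowerSignedSelmerDualData.forall_finite_eq_bot_of_mainThm13
    (hKO : KitajimaOtsuki2018.mainThm13_plusSelmerDual_noFiniteSubmodule)
    (hp2 : p ≠ 2) (hgood : V.HasGoodReductionAtPrime p) (hap : V.frobeniusTrace p = 0)
    (hκ : κ.IsCyclotomic) {γ : Field.absoluteGaloisGroup ℚ} (hγ : κ.IsTopGenerator γ)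
    (hγK : γ ∈ galRange (K := ℚ) K₀)
    (hSel : (signedSelmerInfty (V.baseChange K₀)
        (restrictGal K₀ κ (kappa_surjOn_galRange_cyclotomic κ K₀)) 1).map
      (towerTransport K₀ V κ (kappa_surjOn_galRange_cyclotomic κ K₀)) =
        towerSignedSelmerInfty V κ K₀ ℚ_[p] 1)
    (D : TowerSignedSelmerDualData V κ K₀ ℚ_[p] γ 1) [Module.Finite (IwasawaAlgebra p) D.X]
    (htor : Module.IsTorsion (IwasawaAlgebra p) D.X) :
    ∀ N : Submodule (IwasawaAlgebra p) D.X, Finite N → N = ⊥ := by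
  set hκ₀ := kappa_surjOn_galRange_cyclotomic κ K₀
  set γ' : Field.absoluteGaloisGroup K₀ := rangeToResGal (K := ℚ) K₀ ⟨γ, hγK⟩ with hγ'_def
  have hγ' : resGal (K := ℚ) K₀ γ' = γ := resGal_rangeToResGal (K := ℚ) K₀ ⟨γ, hγK⟩
  have hgen : (restrictGal K₀ κ hκ₀).IsTopGenerator γ' := by
    rw [isTopGenerator_restrictGal_iff, hγ']
    exact hγ
  haveI : Module.Finite (IwasawaAlgebra p) (D.toKobayashi γ' hγ' hSel).X := ‹_›
  exact hKO V p hp2 hgood hap K₀ (V.baseChange K₀) ⟨1, one_smul _ _⟩ (restrictGal K₀ κ hκ₀) γ'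
    (isCyclotomic_restrictGal K₀ κ hκ₀ hκ) hgen (D.toKobayashi γ' hγ' hSel) htor

end Delivery

end Summit.BirchSwinnertonDyer.Rank1Residual.Additive

end
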